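import Literature.AlgebraicGeometry.Motives.ToProjFunctionField
import Literature.AlgebraicGeometry.Motives.ProjectiveSpaceFunctionField
import Literature.AlgebraicGeometry.Motives.VarietiesProjectiveSpaceProofs
import Literature.AlgebraicGeometry.Resolution.DerivativeIdealSheaf
import Mathlib.AlgebraicGeometry.Morphisms.Etale
import Mathlib.AlgebraicGeometry.Morphisms.Smooth
import Mathlib.AlgebraicGeometry.Noetherian
import Mathlib.AlgebraicGeometry.FunctionField
import Mathlib.RingTheory.Unramified.LocalStructure
import Mathlib.RingTheory.Smooth.StandardSmoothOfFree
import HarnessLib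

/-!
# Kedlaya's étale covers, chart calculus: étale coordinates and étaleness over the last chart

Topic `Literature/AlgebraicGeometry/Resolution`; theorem-only support for the discharge of
`Literature.AlgebraicGeometry.Resolution.Kedlaya2004_finite_etale_off_hyperplane`
(`KedlayaEtaleCovers.lean`; K. S. Kedlaya, J. Algebraic Geom. 14 (2005), Thm. 1: "`f` is étale away
from the hyperplane `H ⊆ ℙⁿ` at infinity"). The `k`-structure on sections `k → Γ(X, 𝒪_X) → Γ(X, U)`
is the tree's `Literature.AlgebraicGeometry.Resolution.sectionsHom (Segre.pull f₀) U`
(`DerivativeIdealSheaf.lean`).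

* `Kedlaya2004.etale_morphismRestrict_toProj` — for the morphism `ψ = G.toProj f₀ : X → ℙⁿ_k` of
  generating sections `u₀, …, uₙ` (`Motives/MorphismsToProjectiveSpace`): **if `X_{uₙ}` is affine and
  the coordinate ring map `k[y₀, …, y_{n-1}] → Γ(X, X_{uₙ})`, `y_j ↦ u_j/uₙ`, is étale, then
  `ψ|_{ψ⁻¹ D₊(yₙ)}` is étale** (`ψ⁻¹ D₊(yₙ) = X_{uₙ}`, `GeneratingSections.toProj_preimage_U`;
  `ψ| ≫ (D₊(yₙ) ≅ Spec (k[y]_{(yₙ)})₀) = toSpecΓ ≫ Spec(chartRingHom)`,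
  `GeneratingSections.morphismRestrict_toProj_chartLift`; and `chartRingHom` dehomogenised by
  `ProjectiveSpace.chartAlgEquiv` is the coordinate ring map, `chartRingHom_comp_chartAlgEquiv_symm`);
* `Kedlaya2004.smoothOfRelativeDimension_ι_comp` — if `k → Γ(X, U)` is standard smooth of relative
  dimension `n` (`U` affine) then `U → Spec k` is smooth of relative dimension `n`;
* `Kedlaya2004.exists_etale_coordinates` — **étale coordinates around the generic point**: for `X`
  integral, locally of finite type over a PERFECT field, every open `V₀ ∋ η` contains an affine open
  `V ∋ η` with an ÉTALE `k[x_1, …, x_n]`-algebra structure on `Γ(X, V)` compatible with the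
  `k`-structure (Kedlaya's "regular functions `f_1, …, f_n` on `U` which induce a map `U → 𝔸ⁿ`
  unramified", proof of Lemma 6, at the generic point: Mathlib's generic smoothness
  `Scheme.Hom.genericPoint_mem_smoothLocus_of_perfectField` and the local structure of smooth
  algebras `Algebra.IsSmoothAt.exists_isStandardEtale_mvPolynomial`), its restriction to basic opens
  (`exists_etale_coordinates_basicOpen`) and the consequence "standard smooth of relative dimension
  `n`" (`isStandardSmoothOfRelativeDimension_of_etale_mvPolynomial`).

[folklore] plumbing (Hartshorne II Thm. 7.1; Görtz–Wedhorn I (13.11); Stacks 00TA, 00UE, 056V);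
theorem-only, no named facts.

## References

* K. S. Kedlaya, *More étale covers of affine spaces in positive characteristic*, J. Algebraic
  Geom. 14 (2005) 187–192, proofs of Lemma 6 and Thm. 1. [Kedlaya2004]
* R. Hartshorne, *Algebraic Geometry* (1977), II Thm. 7.1 and Prop. 2.5 (b). [Hartshorne1977]
-/

noncomputable section

universe u

open CategoryTheory AlgebraicGeometry TopologicalSpace Opposite HomogeneousLocalization
open Literature.AlgebraicGeometry.Motives Literature.AlgebraicGeometry.Motives.Segre

attribute [local instance] MvPolynomial.gradedAlgebra
  Literature.AlgebraicGeometry.Motives.ProjBaseChange.algebraBase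

namespace Literature.AlgebraicGeometry.Resolution

namespace Kedlaya2004

/-! ### The `k`-structure on sections: `sectionsHom (pull f₀)` -/

section KStructure

variable {k : Type u} [CommRing k] {X : Scheme.{u}} (f₀ : X ⟶ Spec (.of k))

/-- Elementwise form of `map_comp_sectionsHom`: restriction maps are compatible with the
`k`-structures. [folklore] -/
theorem map_sectionsHom_apply {U V : X.Opens} (h : V ≤ U) (c : k) :
    X.presheaf.map (homOfLE h).op (sectionsHom (pull f₀) U c) = sectionsHom (pull f₀) V c := by
  rw [← map_comp_sectionsHom (pull f₀) h]; rfl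

/-- Any restriction morphism in `(Opens X)ᵒᵖ` out of `⊤` computes `sectionsHom`. [folklore] -/
theorem map_pull_eq_sectionsHom {U : X.Opens} (ι : op (⊤ : X.Opens) ⟶ op U) (c : k) :
    X.presheaf.map ι (pull f₀ c) = sectionsHom (pull f₀) U c := by
  rw [Subsingleton.elim ι (homOfLE (le_top : U ≤ ⊤)).op]; rfl

omit f₀ in
/-- Functoriality of the structure presheaf, elementwise (stated so that `exact` can use it across
the definitional identifications `Γ(U, ⊤) = Γ(X, U.ι(⊤))`). [folklore] -/
theorem map_map_apply (X : Scheme.{u}) {U V W : (X.Opens)ᵒᵖ} (a : U ⟶ V) (b : V ⟶ W)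
    (x : X.presheaf.obj U) : X.presheaf.map b (X.presheaf.map a x) = X.presheaf.map (a ≫ b) x := by
  rw [X.presheaf.map_comp]; rfl

/-- `sectionsHom (pull f₀)` is `f₀^*` on the top opens followed by restriction (`Γ(Spec k, ⊤) ≅ k`).
[folklore] -/
theorem sectionsHom_pull_eq_appLE_comp (U : X.Opens) :
    sectionsHom (pull f₀) U = (f₀.appLE ⊤ U le_top).hom.comp (Scheme.ΓSpecIso (.of k)).inv.hom := by
  unfold sectionsHom pull
  rw [Scheme.Hom.appLE, CommRingCat.hom_comp, CommRingCat.hom_comp, RingHom.comp_assoc]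
  rfl

/-- On an affine open of a `k`-scheme locally of finite type, `k → Γ(X, U)` is of finite type.
[folklore] -/
theorem finiteType_sectionsHom_pull [LocallyOfFiniteType f₀] {U : X.Opens} (hU : IsAffineOpen U) :
    (sectionsHom (pull f₀) U).FiniteType := by
  rw [sectionsHom_pull_eq_appLE_comp]
  exact (f₀.finiteType_appLE (isAffineOpen_top _) hU le_top).comp
    (RingHom.FiniteType.of_surjective _
      (Scheme.ΓSpecIso (.of k)).symm.commRingCatIsoToRingEquiv.surjective)

/-- `(U.ι ≫ f₀)^*` on global sections is `sectionsHom` on the open `U.ι(⊤) = U`, up to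
`Γ(Spec k) ≅ k`. [folklore] -/
theorem appTop_ι_comp (U : X.Opens) :
    (U.ι ≫ f₀).appTop.hom.comp (Scheme.ΓSpecIso (.of k)).inv.hom =
      sectionsHom (pull f₀) (U.ι ''ᵁ ⊤) := by
  rw [Scheme.Hom.comp_appTop, CommRingCat.hom_comp, Scheme.Opens.ι_appTop]
  rfl

end KStructure

/-! ### Ring-level smoothness of relative dimension `n` on an affine open -/

section RelDim

variable {k : Type u} [Field k] {X : Scheme.{u}} (f₀ : X ⟶ Spec (.of k)) {n : ℕ}

/-- **If `k → Γ(X, U)` is standard smooth of relative dimension `n` on the affine open `U`, then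
`U → Spec k` is smooth of relative dimension `n`** (the ring-hom property defining
`SmoothOfRelativeDimension`, on the affine pieces `U`, `Spec k`). [folklore] -/
theorem smoothOfRelativeDimension_ι_comp {U : X.Opens} (hU : IsAffineOpen U)
    (h : (sectionsHom (pull f₀) U).IsStandardSmoothOfRelativeDimension n) :
    SmoothOfRelativeDimension n (U.ι ≫ f₀) := by
  haveI : IsAffine U := hU
  rw [HasRingHomProperty.iff_of_isAffine (P := @SmoothOfRelativeDimension n)]
  refine RingHom.locally_of RingHom.isStandardSmoothOfRelativeDimension_respectsIso _ ?_
  -- transport `h` along `U.ι ''ᵁ ⊤ = U` and `Γ(Spec k, ⊤) ≅ k`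
  have hle : U.ι ''ᵁ ⊤ ≤ U := (Scheme.Opens.ι_image_top U).le
  have h1 : (sectionsHom (pull f₀) (U.ι ''ᵁ ⊤)).IsStandardSmoothOfRelativeDimension n := by
    rw [← map_comp_sectionsHom (pull f₀) hle]
    have hiso : IsIso (X.presheaf.map (homOfLE hle).op) := by
      have : homOfLE hle = eqToHom (Scheme.Opens.ι_image_top U) := Subsingleton.elim _ _
      rw [this, eqToHom_op]
      infer_instance
    exact RingHom.isStandardSmoothOfRelativeDimension_respectsIso.1 (sectionsHom (pull f₀) U)
      (asIso (X.presheaf.map (homOfLE hle).op)).commRingCatIsoToRingEquiv h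
  have h2 := RingHom.isStandardSmoothOfRelativeDimension_respectsIso.2
    (sectionsHom (pull f₀) (U.ι ''ᵁ ⊤)) (Scheme.ΓSpecIso (.of k)).commRingCatIsoToRingEquiv h1
  rw [← appTop_ι_comp f₀ U] at h2
  have key : ((U.ι ≫ f₀).appTop.hom.comp (Scheme.ΓSpecIso (.of k)).inv.hom).comp
      (Scheme.ΓSpecIso (.of k)).commRingCatIsoToRingEquiv.toRingHom = (U.ι ≫ f₀).appTop.hom :=
    RingHom.ext fun x => by
      change (U.ι ≫ f₀).appTop.hom
        (((Scheme.ΓSpecIso (.of k)).hom ≫ (Scheme.ΓSpecIso (.of k)).inv) x) = _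
      rw [Iso.hom_inv_id]
      rfl
  exact (congrArg (RingHom.IsStandardSmoothOfRelativeDimension n) key).mp h2

/-- A `k`-algebra étale over `k[x_1, …, x_n]` is standard smooth of relative dimension `n` over `k`
(`k[x]` is so, `ProjectiveSpace.isStandardSmoothOfRelativeDimension_mvPolynomial_fin`, and étale is
standard smooth of relative dimension `0`). [folklore] -/
theorem isStandardSmoothOfRelativeDimension_of_etale_mvPolynomial {A : Type u} [CommRing A]
    [Algebra k A] [Algebra (MvPolynomial (Fin n) k) A] [IsScalarTower k (MvPolynomial (Fin n) k) A]
    [Algebra.Etale (MvPolynomial (Fin n) k) A] :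
    Algebra.IsStandardSmoothOfRelativeDimension n k A := by
  haveI : Algebra.IsStandardSmoothOfRelativeDimension 0 (MvPolynomial (Fin n) k) A :=
    Algebra.Etale.iff_isStandardSmoothOfRelativeDimension_zero.mp inferInstance
  haveI := ProjectiveSpace.isStandardSmoothOfRelativeDimension_mvPolynomial_fin k n
  have h := Algebra.IsStandardSmoothOfRelativeDimension.trans n 0 k (MvPolynomial (Fin n) k) A
  rwa [zero_add] at h

end RelDim

/-! ### The coordinate ring map of the last chart -/

section Chart

variable {k : Type u} [Field k] {X : Scheme.{u}} {n : ℕ} (G : GeneratingSections (Fin (n + 1)) X)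
  (f₀ : X ⟶ Spec (.of k))

/-- The dehomogenisation generator `x_{l.succAbove j}/x_l` of `ProjectiveSpace.chartAlgEquiv` is the
coordinate fraction `Segre.frac`. [folklore] -/
theorem chartGen_eq_frac (l : Fin (n + 1)) (j : Fin n) :
    ProjectiveSpace.chartGen k l j = frac k l (l.succAbove j) := by
  apply HomogeneousLocalization.val_injective
  rw [ProjectiveSpace.val_chartGen, val_frac]
  exact Localization.mk_eq_mk_iff.mpr (Localization.r_of_eq (by simp))

/-- **The chart ring map of `ψ` over `D₊(yₙ)`, dehomogenised, is the coordinate ring map**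
`k[y₀, …, y_{n-1}] → Γ(X, X_{uₙ})`, `y_j ↦ u_j/uₙ` (constants through `sectionsHom (pull f₀)`), read in
`Γ(ψ⁻¹ D₊(yₙ), 𝒪)` through `Γ(X, X_{uₙ}) → Γ(X, ψ⁻¹D₊(yₙ)) ≅ Γ(ψ⁻¹ D₊(yₙ), 𝒪)`
(Hartshorne II, proof of Thm. 7.1: "`x_j/x_i ↦ s_j/s_i`"). [cite: Hartshorne1977, II Thm. 7.1 (proof)] -/
theorem chartRingHom_comp_chartAlgEquiv_symm :
    (G.chartRingHom f₀ (Fin.last n) (G.toProj f₀ ⁻¹ᵁ ProjSpace.U (Fin.last n)).ι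
        (G.top_le_preimage_U f₀ (Fin.last n))).comp
      (ProjectiveSpace.chartAlgEquiv k (Fin.last n)).symm.toRingHom =
    ((G.toProj f₀ ⁻¹ᵁ ProjSpace.U (Fin.last n)).topIso.inv.hom.comp
      (X.presheaf.map (homOfLE (G.toProj_preimage_U f₀ (Fin.last n)).le).op).hom).comp
      (MvPolynomial.eval₂Hom (sectionsHom (pull f₀) (G.U (Fin.last n)))
        (fun j => G.ratio (Fin.last n) (Fin.castSucc j))) := by
  have hle : G.toProj f₀ ⁻¹ᵁ ProjSpace.U (Fin.last n) ≤ G.U (Fin.last n) :=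
    (G.toProj_preimage_U f₀ (Fin.last n)).le
  have hg : ⊤ ≤ (G.toProj f₀ ⁻¹ᵁ ProjSpace.U (Fin.last n)).ι ⁻¹ᵁ G.U (Fin.last n) :=
    G.top_le_preimage_U f₀ (Fin.last n)
  -- both sides read through `sectionsHom` on the image open
  have hsec1 : ∀ c : k, (G.toProj f₀ ⁻¹ᵁ ProjSpace.U (Fin.last n)).ι.appTop (pull f₀ c) =
      sectionsHom (pull f₀) ((G.toProj f₀ ⁻¹ᵁ ProjSpace.U (Fin.last n)).ι ''ᵁ ⊤) c := fun c => by
    rw [Scheme.Opens.ι_appTop]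
    exact map_pull_eq_sectionsHom f₀ _ c
  have hsec2 : ∀ c : k, (G.toProj f₀ ⁻¹ᵁ ProjSpace.U (Fin.last n)).topIso.inv
      (sectionsHom (pull f₀) (G.toProj f₀ ⁻¹ᵁ ProjSpace.U (Fin.last n)) c) =
      sectionsHom (pull f₀) ((G.toProj f₀ ⁻¹ᵁ ProjSpace.U (Fin.last n)).ι ''ᵁ ⊤) c := fun c => by
    rw [Scheme.Opens.topIso_inv]
    exact (map_map_apply X _ _ (pull f₀ c)).trans (map_pull_eq_sectionsHom f₀ _ c)
  -- the ratios, restricted to `ψ⁻¹ D₊(yₙ)`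
  have hres : ∀ r : Γ(X, G.U (Fin.last n)),
      GeneratingSections.res (G.toProj f₀ ⁻¹ᵁ ProjSpace.U (Fin.last n)).ι (G.U (Fin.last n)) hg r =
      (G.toProj f₀ ⁻¹ᵁ ProjSpace.U (Fin.last n)).topIso.inv (X.presheaf.map (homOfLE hle).op r) :=
    fun r => by
      rw [← GeneratingSections.topIso_hom_res hle r, Iso.hom_inv_id_apply]
  refine MvPolynomial.ringHom_ext (fun c => ?_) (fun j => ?_)
  · -- constants
    have e1 : (ProjectiveSpace.chartAlgEquiv k (Fin.last n)).symm.toRingHom (MvPolynomial.C c) =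
        cst k (MvPolynomial.X (Fin.last n)) c := by
      rw [← MvPolynomial.algebraMap_eq]
      exact (ProjectiveSpace.chartAlgEquiv k (Fin.last n)).symm.commutes c
    have e2 : G.chartRingHom f₀ (Fin.last n) (G.toProj f₀ ⁻¹ᵁ ProjSpace.U (Fin.last n)).ι hg
        (cst k (MvPolynomial.X (Fin.last n)) c) =
        pull ((G.toProj f₀ ⁻¹ᵁ ProjSpace.U (Fin.last n)).ι ≫ f₀) c := by
      rw [← RingHom.comp_apply, GeneratingSections.chartRingHom_comp_cst]
    have hL : ((G.chartRingHom f₀ (Fin.last n) (G.toProj f₀ ⁻¹ᵁ ProjSpace.U (Fin.last n)).ι hg).comp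
        (ProjectiveSpace.chartAlgEquiv k (Fin.last n)).symm.toRingHom) (MvPolynomial.C c) =
        sectionsHom (pull f₀) ((G.toProj f₀ ⁻¹ᵁ ProjSpace.U (Fin.last n)).ι ''ᵁ ⊤) c := by
      rw [RingHom.comp_apply, e1, e2, pull_comp, RingHom.comp_apply]
      exact hsec1 c
    have hR : (((G.toProj f₀ ⁻¹ᵁ ProjSpace.U (Fin.last n)).topIso.inv.hom.comp
        (X.presheaf.map (homOfLE hle).op).hom).comp
        (MvPolynomial.eval₂Hom (sectionsHom (pull f₀) (G.U (Fin.last n)))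
          (fun j => G.ratio (Fin.last n) (Fin.castSucc j)))) (MvPolynomial.C c) =
        sectionsHom (pull f₀) ((G.toProj f₀ ⁻¹ᵁ ProjSpace.U (Fin.last n)).ι ''ᵁ ⊤) c := by
      calc _ = (G.toProj f₀ ⁻¹ᵁ ProjSpace.U (Fin.last n)).topIso.inv.hom
            ((X.presheaf.map (homOfLE hle).op).hom
              (MvPolynomial.eval₂Hom (sectionsHom (pull f₀) (G.U (Fin.last n)))
                (fun j => G.ratio (Fin.last n) (Fin.castSucc j)) (MvPolynomial.C c))) := rfl
        _ = (G.toProj f₀ ⁻¹ᵁ ProjSpace.U (Fin.last n)).topIso.inv.hom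
            ((X.presheaf.map (homOfLE hle).op).hom (sectionsHom (pull f₀) (G.U (Fin.last n)) c)) :=
          congrArg (fun x => (G.toProj f₀ ⁻¹ᵁ ProjSpace.U (Fin.last n)).topIso.inv.hom
            ((X.presheaf.map (homOfLE hle).op).hom x)) (MvPolynomial.eval₂Hom_C _ _ c)
        _ = (G.toProj f₀ ⁻¹ᵁ ProjSpace.U (Fin.last n)).topIso.inv.hom
            (sectionsHom (pull f₀) (G.toProj f₀ ⁻¹ᵁ ProjSpace.U (Fin.last n)) c) :=
          congrArg (fun x => (G.toProj f₀ ⁻¹ᵁ ProjSpace.U (Fin.last n)).topIso.inv.hom x)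
            (map_sectionsHom_apply f₀ hle c)
        _ = _ := hsec2 c
    exact hL.trans hR.symm
  · -- variables
    have hL : ((G.chartRingHom f₀ (Fin.last n) (G.toProj f₀ ⁻¹ᵁ ProjSpace.U (Fin.last n)).ι hg).comp
        (ProjectiveSpace.chartAlgEquiv k (Fin.last n)).symm.toRingHom) (MvPolynomial.X j) =
        GeneratingSections.res (G.toProj f₀ ⁻¹ᵁ ProjSpace.U (Fin.last n)).ι (G.U (Fin.last n)) hg
          (G.ratio (Fin.last n) (Fin.castSucc j)) := by
      calc _ = G.chartRingHom f₀ (Fin.last n) (G.toProj f₀ ⁻¹ᵁ ProjSpace.U (Fin.last n)).ι hg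
            ((ProjectiveSpace.chartAlgEquiv k (Fin.last n)).symm (MvPolynomial.X j)) := rfl
        _ = G.chartRingHom f₀ (Fin.last n) (G.toProj f₀ ⁻¹ᵁ ProjSpace.U (Fin.last n)).ι hg
            (frac k (Fin.last n) ((Fin.last n).succAbove j)) :=
          congrArg (fun x => G.chartRingHom f₀ (Fin.last n)
            (G.toProj f₀ ⁻¹ᵁ ProjSpace.U (Fin.last n)).ι hg x)
            ((ProjectiveSpace.chartAlgEquiv_symm_X k (Fin.last n) j).trans
              (chartGen_eq_frac (Fin.last n) j))
        _ = GeneratingSections.res (G.toProj f₀ ⁻¹ᵁ ProjSpace.U (Fin.last n)).ι (G.U (Fin.last n)) hg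
            (G.ratio (Fin.last n) ((Fin.last n).succAbove j)) :=
          GeneratingSections.chartRingHom_frac G f₀ (Fin.last n) _ hg _
        _ = _ := congrArg (fun i => GeneratingSections.res (G.toProj f₀ ⁻¹ᵁ ProjSpace.U (Fin.last n)).ι
            (G.U (Fin.last n)) hg (G.ratio (Fin.last n) i)) (congrFun Fin.succAbove_last j)
    have hR : (((G.toProj f₀ ⁻¹ᵁ ProjSpace.U (Fin.last n)).topIso.inv.hom.comp
        (X.presheaf.map (homOfLE hle).op).hom).comp
        (MvPolynomial.eval₂Hom (sectionsHom (pull f₀) (G.U (Fin.last n)))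
          (fun j => G.ratio (Fin.last n) (Fin.castSucc j)))) (MvPolynomial.X j) =
        GeneratingSections.res (G.toProj f₀ ⁻¹ᵁ ProjSpace.U (Fin.last n)).ι (G.U (Fin.last n)) hg
          (G.ratio (Fin.last n) (Fin.castSucc j)) := by
      calc _ = (G.toProj f₀ ⁻¹ᵁ ProjSpace.U (Fin.last n)).topIso.inv.hom
            ((X.presheaf.map (homOfLE hle).op).hom
              (MvPolynomial.eval₂Hom (sectionsHom (pull f₀) (G.U (Fin.last n)))
                (fun j => G.ratio (Fin.last n) (Fin.castSucc j)) (MvPolynomial.X j))) := rfl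
        _ = (G.toProj f₀ ⁻¹ᵁ ProjSpace.U (Fin.last n)).topIso.inv.hom
            ((X.presheaf.map (homOfLE hle).op).hom (G.ratio (Fin.last n) (Fin.castSucc j))) :=
          congrArg (fun x => (G.toProj f₀ ⁻¹ᵁ ProjSpace.U (Fin.last n)).topIso.inv.hom
            ((X.presheaf.map (homOfLE hle).op).hom x)) (MvPolynomial.eval₂Hom_X' _ _ j)
        _ = _ := (hres _).symm
    exact hL.trans hR.symm

/-- **Étaleness of `ψ` over the last chart from the coordinate ring map.** If `X_{uₙ}` is affine and
the coordinate ring map `k[y₀, …, y_{n-1}] → Γ(X, X_{uₙ})`, `y_j ↦ u_j/uₙ`, is étale, then the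
restriction of `ψ = G.toProj f₀ : X → ℙⁿ_k` over `D₊(yₙ)` is étale (Kedlaya 2004, Thm. 1 (b): "`f` is
étale away from the hyperplane at infinity", in the form `Etale (f ∣_ D₊(yₙ))`).
[cite: Kedlaya2004, Thm. 1 (b)] -/
theorem etale_morphismRestrict_toProj (hU : IsAffineOpen (G.U (Fin.last n)))
    (hθ : (MvPolynomial.eval₂Hom (sectionsHom (pull f₀) (G.U (Fin.last n)))
      (fun j => G.ratio (Fin.last n) (Fin.castSucc j))).Etale) :
    Etale (G.toProj f₀ ∣_ ProjSpace.U (Fin.last n)) := by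
  have hWU : G.toProj f₀ ⁻¹ᵁ ProjSpace.U (Fin.last n) = G.U (Fin.last n) :=
    G.toProj_preimage_U f₀ (Fin.last n)
  have hle : G.toProj f₀ ⁻¹ᵁ ProjSpace.U (Fin.last n) ≤ G.U (Fin.last n) := hWU.le
  haveI : IsAffine (G.toProj f₀ ⁻¹ᵁ ProjSpace.U (Fin.last n)) := by rw [hWU]; exact hU
  haveI := ProjSpace.isIso_chartLift (d := n) (K := k) (Fin.last n)
  -- the chart ring map is étale
  have hiso : IsIso (X.presheaf.map (homOfLE hle).op) := by
    have : homOfLE hle = eqToHom hWU := Subsingleton.elim _ _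
    rw [this, eqToHom_op]
    infer_instance
  have h1 : ((((G.toProj f₀ ⁻¹ᵁ ProjSpace.U (Fin.last n)).topIso.inv.hom.comp
      (X.presheaf.map (homOfLE hle).op).hom).comp
      (MvPolynomial.eval₂Hom (sectionsHom (pull f₀) (G.U (Fin.last n)))
        (fun j => G.ratio (Fin.last n) (Fin.castSucc j))))).Etale := by
    rw [RingHom.comp_assoc]
    exact RingHom.Etale.respectsIso.1 _
      (G.toProj f₀ ⁻¹ᵁ ProjSpace.U (Fin.last n)).topIso.symm.commRingCatIsoToRingEquiv
      (RingHom.Etale.respectsIso.1 _ (asIso (X.presheaf.map (homOfLE hle).op)).commRingCatIsoToRingEquiv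
        hθ)
  rw [← chartRingHom_comp_chartAlgEquiv_symm] at h1
  have h2 := RingHom.Etale.respectsIso.2 _ (ProjectiveSpace.chartAlgEquiv k (Fin.last n)).toRingEquiv h1
  have key : ((G.chartRingHom f₀ (Fin.last n) (G.toProj f₀ ⁻¹ᵁ ProjSpace.U (Fin.last n)).ι
      (G.top_le_preimage_U f₀ (Fin.last n))).comp
      (ProjectiveSpace.chartAlgEquiv k (Fin.last n)).symm.toRingHom).comp
      (ProjectiveSpace.chartAlgEquiv k (Fin.last n)).toRingEquiv.toRingHom =
      G.chartRingHom f₀ (Fin.last n) (G.toProj f₀ ⁻¹ᵁ ProjSpace.U (Fin.last n)).ι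
        (G.top_le_preimage_U f₀ (Fin.last n)) :=
    RingHom.ext fun x => by
      change G.chartRingHom f₀ (Fin.last n) _ _ ((ProjectiveSpace.chartAlgEquiv k (Fin.last n)).symm
        (ProjectiveSpace.chartAlgEquiv k (Fin.last n) x)) = _
      rw [AlgEquiv.symm_apply_apply]
  have h2' := (congrArg RingHom.Etale key).mp h2
  -- hence `Spec` of it, hence `ψ| ≫ chart iso`, hence `ψ|`
  have h3 : Etale (Scheme.toSpecΓ (G.toProj f₀ ⁻¹ᵁ ProjSpace.U (Fin.last n)) ≫
      Spec.map (CommRingCat.ofHom (G.chartRingHom f₀ (Fin.last n)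
        (G.toProj f₀ ⁻¹ᵁ ProjSpace.U (Fin.last n)).ι (G.top_le_preimage_U f₀ (Fin.last n))))) := by
    rw [MorphismProperty.cancel_left_of_respectsIso @Etale]
    exact HasRingHomProperty.Spec_iff.mpr h2'
  rw [← GeneratingSections.morphismRestrict_toProj_chartLift] at h3
  exact (MorphismProperty.cancel_right_of_respectsIso @Etale _ _).mp h3

end Chart

/-! ## Étale coordinates around the generic point -/

section Coordinates

variable {k : Type u} [Field k] {X : Scheme.{u}} (f₀ : X ⟶ Spec (.of k)) {n : ℕ}

/-- **Étale coordinates restrict to basic opens**: an étale `k[x_1, …, x_n]`-algebra structure on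
`Γ(X, V)` (`V` affine), compatible with the `k`-structure, induces one on `Γ(X, X_r) = Γ(X, V)[r⁻¹]`
whose coordinates are the restricted coordinates. [folklore] -/
theorem exists_etale_coordinates_basicOpen {V : X.Opens} (hV : IsAffineOpen V)
    (alg : Algebra (MvPolynomial (Fin n) k) Γ(X, V))
    (hst : letI := sectionsAlgebra (pull f₀) V; IsScalarTower k (MvPolynomial (Fin n) k) Γ(X, V))
    (het : Algebra.Etale (MvPolynomial (Fin n) k) Γ(X, V)) (r : Γ(X, V)) :
    letI := sectionsAlgebra (pull f₀) (X.basicOpen r)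
    ∃ _ : Algebra (MvPolynomial (Fin n) k) Γ(X, X.basicOpen r),
      IsScalarTower k (MvPolynomial (Fin n) k) Γ(X, X.basicOpen r) ∧
      Algebra.Etale (MvPolynomial (Fin n) k) Γ(X, X.basicOpen r) ∧
      ∀ i, algebraMap (MvPolynomial (Fin n) k) Γ(X, X.basicOpen r) (MvPolynomial.X i) =
        X.presheaf.map (homOfLE (X.basicOpen_le r)).op
          (algebraMap (MvPolynomial (Fin n) k) Γ(X, V) (MvPolynomial.X i)) := by
  letI := sectionsAlgebra (pull f₀) V
  letI := sectionsAlgebra (pull f₀) (X.basicOpen r)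
  letI algPA : Algebra (MvPolynomial (Fin n) k) Γ(X, X.basicOpen r) :=
    ((algebraMap Γ(X, V) Γ(X, X.basicOpen r)).comp
      (algebraMap (MvPolynomial (Fin n) k) Γ(X, V))).toAlgebra
  haveI : IsScalarTower (MvPolynomial (Fin n) k) Γ(X, V) Γ(X, X.basicOpen r) :=
    IsScalarTower.of_algebraMap_eq fun _ => rfl
  haveI := hV.isLocalization_basicOpen r
  haveI : Algebra.Etale Γ(X, V) Γ(X, X.basicOpen r) :=
    ⟨Algebra.FormallyEtale.of_isLocalization (Submonoid.powers r),
      IsLocalization.Away.finitePresentation r⟩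
  refine ⟨algPA, ?_, Algebra.Etale.comp (MvPolynomial (Fin n) k) Γ(X, V) Γ(X, X.basicOpen r),
    fun i => rfl⟩
  refine IsScalarTower.of_algebraMap_eq fun c => ?_
  change sectionsHom (pull f₀) (X.basicOpen r) c =
    algebraMap Γ(X, V) Γ(X, X.basicOpen r) (algebraMap (MvPolynomial (Fin n) k) Γ(X, V)
      (algebraMap k (MvPolynomial (Fin n) k) c))
  rw [← IsScalarTower.algebraMap_apply k (MvPolynomial (Fin n) k) Γ(X, V) c]
  exact (RingHom.congr_fun (map_comp_sectionsHom (pull f₀) (X.basicOpen_le r)) c).symm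

variable [PerfectField k] [IsIntegral X] [LocallyOfFiniteType f₀]

omit [PerfectField k] [IsIntegral X] in
/-- An open of `Spec k` containing a point is everything. [folklore] -/
theorem opens_Spec_field_eq_top (U : (Spec (CommRingCat.of k)).Opens) {x : Spec (CommRingCat.of k)}
    (hx : x ∈ U) : U = ⊤ :=
  top_le_iff.mp fun y _ => by rwa [Subsingleton.elim y x]

/-- **Étale coordinates around the generic point.** For `f₀ : X → Spec k` locally of finite type,
`X` integral and `k` perfect, every open `V₀ ∋ η` contains an affine open `V ∋ η` carrying an ÉTALE
`k[x_1, …, x_n]`-algebra structure on `Γ(X, V)` compatible with the `k`-structure (Kedlaya 2004, proof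
of Lemma 6: "regular functions `f_1, …, f_n` on `U` … which induce a map `U → 𝔸ⁿ` unramified", at
the generic point: generic smoothness over a perfect field and the local structure of smooth
algebras, Stacks 00TA / 00UE). [cite: Kedlaya2004, Lemma 6 (proof)] -/
theorem exists_etale_coordinates (V₀ : X.Opens) (hη₀ : genericPoint X ∈ V₀) :
    ∃ (V : X.Opens) (n : ℕ) (_ : Algebra (MvPolynomial (Fin n) k) Γ(X, V)),
      IsAffineOpen V ∧ genericPoint X ∈ V ∧ V ≤ V₀ ∧
      (letI := sectionsAlgebra (pull f₀) V; IsScalarTower k (MvPolynomial (Fin n) k) Γ(X, V)) ∧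
      Algebra.Etale (MvPolynomial (Fin n) k) Γ(X, V) := by
  classical
  -- generic smoothness
  have hsm : (f₀.stalkMap (genericPoint X)).hom.FormallySmooth :=
    f₀.genericPoint_mem_smoothLocus_of_perfectField
  obtain ⟨U, hU, V, hV, hVU, hηV, hsmooth⟩ := exists_smooth_of_formallySmooth_stalk f₀ _ hsm
  obtain rfl : U = ⊤ := opens_Spec_field_eq_top U (hVU hηV)
  -- `k → Γ(X, V)` is smooth
  have hsecV : (sectionsHom (pull f₀) V).Smooth := by
    rw [sectionsHom_pull_eq_appLE_comp]
    exact RingHom.Smooth.respectsIso.2 _ (Scheme.ΓSpecIso (.of k)).symm.commRingCatIsoToRingEquiv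
      hsmooth
  -- shrink into `V₀`: a basic open `V₁ = X_r`, `η ∈ V₁ ≤ V ⊓ V₀`
  obtain ⟨r, hrle, hηr⟩ :=
    hV.exists_basicOpen_le (V := V ⊓ V₀) ⟨genericPoint X, ⟨hηV, hη₀⟩⟩ hηV
  have hV₁ : IsAffineOpen (X.basicOpen r) := hV.basicOpen r
  letI algV := sectionsAlgebra (pull f₀) V
  letI algV₁ := sectionsAlgebra (pull f₀) (X.basicOpen r)
  haveI : IsScalarTower k Γ(X, V) Γ(X, X.basicOpen r) :=
    IsScalarTower.of_algebraMap_eq fun c =>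
      (RingHom.congr_fun (map_comp_sectionsHom (pull f₀) (X.basicOpen_le r)) c).symm
  haveI := hV.isLocalization_basicOpen r
  haveI : Algebra.Smooth k Γ(X, V) := RingHom.smooth_algebraMap.mp hsecV
  haveI : Algebra.Smooth Γ(X, V) Γ(X, X.basicOpen r) :=
    ⟨Algebra.FormallySmooth.of_isLocalization (Submonoid.powers r),
      IsLocalization.Away.finitePresentation r⟩
  haveI : Algebra.Smooth k Γ(X, X.basicOpen r) := Algebra.Smooth.comp k Γ(X, V) _
  -- local structure of the smooth algebra `Γ(X, V₁)` at the generic point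
  obtain ⟨f₁, hf₁, n, alg, hst, hse⟩ :=
    Algebra.IsSmoothAt.exists_isStandardEtale_mvPolynomial (R := k)
      (p := (hV₁.primeIdealOf ⟨genericPoint X, hηr⟩).asIdeal)
  -- `η ∈ V₂ = X_{f₁}`
  have hηf₁ : genericPoint X ∈ X.basicOpen f₁ := by
    have h1 : hV₁.primeIdealOf ⟨genericPoint X, hηr⟩ ∈ hV₁.fromSpec ⁻¹ᵁ X.basicOpen f₁ := by
      rw [hV₁.fromSpec_preimage_basicOpen]
      exact (PrimeSpectrum.mem_basicOpen _ _).mpr hf₁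
    have h2 : hV₁.fromSpec (hV₁.primeIdealOf ⟨genericPoint X, hηr⟩) ∈ X.basicOpen f₁ := h1
    rwa [hV₁.fromSpec_primeIdealOf] at h2
  have hV₂ : IsAffineOpen (X.basicOpen f₁) := hV₁.basicOpen f₁
  -- transport the `k[x]`-structure from `Localization.Away f₁` to `Γ(X, X_{f₁})`
  letI algV₂ := sectionsAlgebra (pull f₀) (X.basicOpen f₁)
  haveI : IsScalarTower k Γ(X, X.basicOpen r) Γ(X, X.basicOpen f₁) :=
    IsScalarTower.of_algebraMap_eq fun c =>
      (RingHom.congr_fun (map_comp_sectionsHom (pull f₀) (X.basicOpen_le f₁)) c).symm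
  haveI := hV₁.isLocalization_basicOpen f₁
  let eL : Localization.Away f₁ ≃ₐ[Γ(X, X.basicOpen r)] Γ(X, X.basicOpen f₁) :=
    IsLocalization.algEquiv (Submonoid.powers f₁) _ _
  letI algP : Algebra (MvPolynomial (Fin n) k) Γ(X, X.basicOpen f₁) :=
    (eL.toRingHom.comp (algebraMap (MvPolynomial (Fin n) k) (Localization.Away f₁))).toAlgebra
  let eL' : Localization.Away f₁ ≃ₐ[MvPolynomial (Fin n) k] Γ(X, X.basicOpen f₁) :=
    { eL with commutes' := fun _ => rfl }
  haveI hEt : Algebra.Etale (MvPolynomial (Fin n) k) Γ(X, X.basicOpen f₁) := Algebra.Etale.of_equiv eL'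
  have hST : IsScalarTower k (MvPolynomial (Fin n) k) Γ(X, X.basicOpen f₁) := by
    refine IsScalarTower.of_algebraMap_eq fun c => ?_
    change algebraMap k Γ(X, X.basicOpen f₁) c =
      eL (algebraMap (MvPolynomial (Fin n) k) (Localization.Away f₁) (algebraMap k _ c))
    rw [← IsScalarTower.algebraMap_apply k (MvPolynomial (Fin n) k) (Localization.Away f₁),
      IsScalarTower.algebraMap_apply k Γ(X, X.basicOpen r) (Localization.Away f₁), AlgEquiv.commutes,
      ← IsScalarTower.algebraMap_apply]
  refine ⟨X.basicOpen f₁, n, algP, hV₂, hηf₁, ?_, hST, hEt⟩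
  exact (X.basicOpen_le f₁).trans (hrle.trans inf_le_right)

end Coordinates

end Kedlaya2004

end Literature.AlgebraicGeometry.Resolution

end
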